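import Summits.AtomisticToContinuum.HydrodynamicLimit.Theses.JParityClosure

/-!
# Sketch — crux-ideate stmt-AtomisticToContinuum-13081 (LocalSecondLaw), ideator 2, round 1

First-lemma signatures for the idea cards (they need not be proved; they must elaborate).
Vocabulary is that of the route file `JParityClosure`: cone kernel `bx`, mollified empirical
one-body law `hm` (space scale `r`, velocity scale `ϑ`, Gaussian kernel), pre-collisional
velocities `pv`, ONE-point surprisal jump `F1` (all four evaluations at `x_i`, the route's `F`),
TWO-point surprisal jump `F2` (particle `j` evaluated at `x_j = x_i - ε n̂`), and the collision
functional `Kc` with its `ε/(N+1)` normalisation. `(2ε)⁻¹ · Kc[m]` is the per-unit-time,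
per-particle sum over (unordered) collisions of a symmetric mark `m` — the normalisation of an
entropy BALANCE (the route's cruxes use the per-collision normalisation `Kc`).
-/

noncomputable section

namespace Summit.AtomisticToContinuum.HydrodynamicLimit.Cruxes.LocalSecondLaw.IdeatorTwo

open MeasureTheory
open Literature.MathematicalPhysics.KineticTheory (T3 V3 hsDiameter localGibbsLaw
  hsExcessFreeEnergy hardSphereKernel sphereMeasure)
open Literature.Analysis.FluidPDE (HardSphereFlow Config empiricalMeasure collisionTimes reflectVel
  localMaxwellian entropyProduction)

/-! ## Shared vocabulary (verbatim semantics of the route file's `let`s) -/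

/-- The flat 3-torus geometry of the conjunct. -/
abbrev G3 := Literature.Analysis.FluidPDE.Torus.geometry (Fin 3)

/-- Cone mollifier of radius `r` (unit mass for `r < 1/2`). -/
def bx (r : ℝ) (x y : T3) : ℝ :=
  3 / (Real.pi * r ^ 3) * max (1 - Literature.Analysis.FluidPDE.Torus.euclidDist x y / r) 0

/-- `r`-mollified empirical density. -/
def ρm {n : ℕ} (r : ℝ) (z : Config n (Fin 3) T3) (x₀ : T3) : ℝ :=
  ∫ q, bx r q.1 x₀ ∂(empiricalMeasure z)

/-- `r`-mollified empirical momentum. -/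
def mm {n : ℕ} (r : ℝ) (z : Config n (Fin 3) T3) (x₀ : T3) : V3 :=
  ∫ q, bx r q.1 x₀ • q.2 ∂(empiricalMeasure z)


/-- `r`-mollified empirical kinetic energy. -/
def em {n : ℕ} (r : ℝ) (z : Config n (Fin 3) T3) (x₀ : T3) : ℝ :=
  ∫ q, bx r q.1 x₀ * (‖q.2‖ ^ 2 / 2) ∂(empiricalMeasure z)

/-- Empirical temperature `θ_r = (2/3)(e_r/ρ_r − |m_r|²/(2ρ_r²))` (the crux's `θm`). -/
def θm {n : ℕ} (r : ℝ) (z : Config n (Fin 3) T3) (x₀ : T3) : ℝ :=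
  2 / 3 * (em r z x₀ / ρm r z x₀ - ‖mm r z x₀‖ ^ 2 / (2 * ρm r z x₀ ^ 2))

/-- `(r, ϑ)`-mollified empirical one-body law `h^N_{r,ϑ}(x₀, v)` (Gaussian velocity kernel: a
Maxwellian input stays Maxwellian, so `F1 ≡ 0` on local Maxwellians). -/
def hm {n : ℕ} (r ϑ : ℝ) (z : Config n (Fin 3) T3) (x₀ : T3) (v : V3) : ℝ :=
  ∫ q, bx r q.1 x₀ * localMaxwellian 1 (ϑ ^ 2) v q.2 ∂(empiricalMeasure z)

/-- Kinetic entropy `H_K = ∫∫ χ h log h` of the mollified empirical law. -/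
def HK {n : ℕ} (χ : T3 → ℝ) (r ϑ : ℝ) (z : Config n (Fin 3) T3) : ℝ :=
  ∫ x, ∫ v, χ x * (hm r ϑ z x v * Real.log (hm r ϑ z x v))

/-- Pre-collisional velocities of the ordered contact pair `(i, j)` read off the (right-continuous,
post-collisional) configuration. -/
def pv {n : ℕ} (z : Config n (Fin 3) T3) (i j : Fin n) : V3 × V3 :=
  reflectVel (G3.sepVec (z i).1 (z j).1) ((z i).2, (z j).2)

/-- ONE-point surprisal jump (the route's `F`): `log h(v⁻)h(w⁻) − log h(v⁺)h(w⁺)`, all at `x_i`. -/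
def F1 {n : ℕ} (r ϑ : ℝ) (z : Config n (Fin 3) T3) (i j : Fin n) : ℝ :=
  Real.log (hm r ϑ z (z i).1 (pv z i j).1) + Real.log (hm r ϑ z (z i).1 (pv z i j).2)
    - Real.log (hm r ϑ z (z i).1 (z i).2) - Real.log (hm r ϑ z (z i).1 (z j).2)

/-- TWO-point surprisal jump: particle `j`'s law read at `x_j` (the exact first-order jump of `H_K`). -/
def F2 {n : ℕ} (r ϑ : ℝ) (z : Config n (Fin 3) T3) (i j : Fin n) : ℝ :=
  Real.log (hm r ϑ z (z i).1 (pv z i j).1) + Real.log (hm r ϑ z (z j).1 (pv z i j).2)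
    - Real.log (hm r ϑ z (z i).1 (z i).2) - Real.log (hm r ϑ z (z j).1 (z j).2)

/-- The route's collision functional `K_N[m] = (ε/(N+1)) Σ_{collision times ≤ τ} Σ_{ordered contact
pairs} m` along the flow `Φ` from `z`. -/
def Kc (σ : ℝ) (N : ℕ) (Φ : HardSphereFlow G3 (hsDiameter σ N) (N + 1)) (τ : ℝ)
    (Fn : Config (N + 1) (Fin 3) T3 → ℝ → Fin (N + 1) → Fin (N + 1) → ℝ)
    (z : Config (N + 1) (Fin 3) T3) : ℝ :=
  hsDiameter σ N / (N + 1 : ℝ) *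
    ∑ᶠ (s : ℝ) (_ : s ∈ collisionTimes G3 (hsDiameter σ N) (fun s' => Φ.flow s' z) ∩ Set.Icc 0 τ),
      ∑ i : Fin (N + 1), ∑ j : Fin (N + 1),
        (if i ≠ j ∧ ‖G3.sepVec (Φ.flow s z i).1 (Φ.flow s z j).1‖ = hsDiameter σ N
          then Fn (Φ.flow s z) s i j else 0)

/-- Truncated odd-exchange mark `F(1 + e^{−F}) 1(|F| ≤ L)` (J-odd, bounded by `L(1 + e^L)`). -/
def oddMark (L F : ℝ) : ℝ := if |F| ≤ L then F * (1 + Real.exp (-F)) else 0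

/-- Configurational entropy density `H_C(a) = a · f_ex(a σ³)` (junk `0` off `a > 0`). -/
def HC (σ a : ℝ) : ℝ := if 0 < a then a * hsExcessFreeEnergy (a * σ ^ 3) else 0

/-! ## Card 1 — `termwise-surprisal-positivity` -/

/-- CARD 1 core: the four elementary real inequalities that carry the SIGN of the local entropy
balance — termwise positivity of the even part of a surprisal jump, the trivial even/odd split,
DiPerna–Lions-type domination of the odd part by the even part on the dangerous side `F ≤ -L`,
and the tangent (convexity) bound for the jump of `a log a`. -/
def SurprisalSignCore : Prop :=
  (∀ F : ℝ, 0 ≤ F * (1 - Real.exp (-F))) ∧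
  (∀ F : ℝ, F = (F * (1 - Real.exp (-F)) + F * (1 + Real.exp (-F))) / 2) ∧
  (∀ L : ℝ, 0 < L → ∀ F : ℝ, F ≤ -L →
      |F * (1 + Real.exp (-F))| ≤ (1 + 2 / (Real.exp L - 1)) * (F * (1 - Real.exp (-F)))) ∧
  (∀ a b : ℝ, 0 < a → 0 < b → a * Real.log a - b * Real.log b ≤ (1 + Real.log a) * (a - b))

/-- CARD 1 first lemma (jump domination): the jump of the kinetic entropy between ANY two
configurations is dominated by the linearisation at the FINAL law (convexity of `a log a`); with
`z' =` post-, `z =` pre-collisional configuration the right side is `−(N+1)⁻¹ ×` (a `bx ⊗ G_ϑ`-smeared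
two-point surprisal jump read on the post-collisional law) — the direction the balance needs. -/
def JumpDomination : Prop :=
  ∀ (n : ℕ) (χ : T3 → ℝ) (r ϑ : ℝ), (∀ x, 0 ≤ χ x) → 0 < r → 0 < ϑ →
    ∀ z z' : Config n (Fin 3) T3, (∀ x v, 0 < hm r ϑ z x v) → (∀ x v, 0 < hm r ϑ z' x v) →
      HK χ r ϑ z' - HK χ r ϑ z ≤
        ∫ x, ∫ v, χ x * ((1 + Real.log (hm r ϑ z' x v)) * (hm r ϑ z' x v - hm r ϑ z x v))

/-- CARD 1 hard stub / CARD 2 target (`TruncatedOddExchangeLowerBound`): the per-unit-time,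
truncated, J-odd entropy exchange is not macroscopically NEGATIVE — one-sided, Navier–Stokes
precision (`(2ε)⁻¹ Kc`, i.e. `o(ε)` per collision), bounded J-odd mark `oddMark L F1`. Frame = the
route's `OddContactSymmetry` (local Gibbs data, any flows, cutoff `g` below `η₀`, `N → ∞` at fixed
`r, ϑ`). -/
def TruncatedOddExchangeLowerBound : Prop :=
  ∃ η₀ : ℝ, 0 < η₀ ∧ ∀ (a₀ θ₀ : T3 → ℝ) (u₀ : T3 → V3), Continuous a₀ → Continuous θ₀ →
    Continuous u₀ → (∀ x, 0 < a₀ x) → (∀ x, 0 < θ₀ x) → ∃ σ₀ : ℝ, 0 < σ₀ ∧ ∀ σ : ℝ, 0 < σ → σ < σ₀ →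
    ∀ Φ : (N : ℕ) → HardSphereFlow G3 (hsDiameter σ N) (N + 1), ∀ τ : ℝ, 0 < τ →
    ∀ χ : ℝ × T3 → ℝ, Continuous χ → (∀ p, 0 ≤ χ p) →
    ∀ g : ℝ → ℝ, Continuous g → (∀ a, 0 ≤ g a) → (∀ a, η₀ ≤ a → g a = 0) →
    ∀ L : ℝ, 0 < L → ∀ η δ : ℝ, 0 < η → 0 < δ → ∃ r₀ : ℝ, 0 < r₀ ∧ ∀ r ϑ : ℝ, 0 < r → r < r₀ →
    0 < ϑ → ϑ < r₀ → ∃ N₀ : ℕ, ∀ N : ℕ, N₀ ≤ N →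
      let ε := hsDiameter σ N
      let D : Config (N + 1) (Fin 3) T3 → ℝ := fun z =>
        (2 * ε)⁻¹ * Kc σ N (Φ N) τ
          (fun w s i j => χ (s, (w i).1) * g (σ ^ 3 * ρm r w (w i).1) * oddMark L (F1 r ϑ w i j)) z
      localGibbsLaw σ a₀ u₀ θ₀ N (Φ N) {z | D z < -η} ≤ ENNReal.ofReal δ


/-- CARD 1 stub S7 (`ColdSpotsNegligible`): Gaussian maximum entropy compares the kinetic entropy `H_K`
(two-sided bounded pathwise) with the hydrodynamic kinetic entropy at temperature `θ_r + ϑ²`; the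
cold-ball divergence of the crux's `H(θ_r)` (Disproof.lean §(b): no pathwise lower bound) is thereby
isolated in the explicit non-negative field `(3/2) ρ_r log(1 + ϑ²/θ_r)`, which must carry vanishing
space–time mass: no macroscopic absolute-zero spots (implied by any temperature floor in probability). -/
def ColdSpotsNegligible : Prop :=
  ∀ (a₀ θ₀ : T3 → ℝ) (u₀ : T3 → V3), Continuous a₀ → Continuous θ₀ → Continuous u₀ →
    (∀ x, 0 < a₀ x) → (∀ x, 0 < θ₀ x) → ∃ σ₀ : ℝ, 0 < σ₀ ∧ ∀ σ : ℝ, 0 < σ → σ < σ₀ →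
    ∀ Φ : (N : ℕ) → HardSphereFlow G3 (hsDiameter σ N) (N + 1), ∀ τ : ℝ, 0 < τ →
    ∀ η δ : ℝ, 0 < η → 0 < δ → ∃ r₀ : ℝ, 0 < r₀ ∧ ∀ r ϑ : ℝ, 0 < r → r < r₀ → 0 < ϑ → ϑ < r₀ →
    ∃ N₀ : ℕ, ∀ N : ℕ, N₀ ≤ N →
      let D : Config (N + 1) (Fin 3) T3 → ℝ := fun z =>
        ∫ s in Set.Icc (0 : ℝ) τ, ∫ x : T3,
          ρm r ((Φ N).flow s z) x * Real.log (1 + ϑ ^ 2 / θm r ((Φ N).flow s z) x)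
      localGibbsLaw σ a₀ u₀ θ₀ N (Φ N) {z | η < D z} ≤ ENNReal.ofReal δ

/-! ## Card 2 — `production-currency` -/

/-- CARD 2 first lemma (`ProductionBudget`): the per-unit-time even production
`(2ε)⁻¹ Kc[χ g F(1−e^{−F})]` (termwise ≥ 0) is TIGHT along forward local-Gibbs evolutions — the
currency in which tails, odd exchange and Maxwellian defect are paid. -/
def ProductionBudget : Prop :=
  ∃ η₀ : ℝ, 0 < η₀ ∧ ∀ (a₀ θ₀ : T3 → ℝ) (u₀ : T3 → V3), Continuous a₀ → Continuous θ₀ →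
    Continuous u₀ → (∀ x, 0 < a₀ x) → (∀ x, 0 < θ₀ x) → ∃ σ₀ : ℝ, 0 < σ₀ ∧ ∀ σ : ℝ, 0 < σ → σ < σ₀ →
    ∀ Φ : (N : ℕ) → HardSphereFlow G3 (hsDiameter σ N) (N + 1), ∀ τ : ℝ, 0 < τ →
    ∀ χ : ℝ × T3 → ℝ, Continuous χ → (∀ p, 0 ≤ χ p) →
    ∀ g : ℝ → ℝ, Continuous g → (∀ a, 0 ≤ g a) → (∀ a, η₀ ≤ a → g a = 0) →
    ∀ δ : ℝ, 0 < δ → ∃ M : ℝ, ∃ r₀ : ℝ, 0 < r₀ ∧ ∀ r ϑ : ℝ, 0 < r → r < r₀ → 0 < ϑ → ϑ < r₀ →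
    ∃ N₀ : ℕ, ∀ N : ℕ, N₀ ≤ N →
      let ε := hsDiameter σ N
      let P : Config (N + 1) (Fin 3) T3 → ℝ := fun z =>
        (2 * ε)⁻¹ * Kc σ N (Φ N) τ
          (fun w s i j => χ (s, (w i).1) * g (σ ^ 3 * ρm r w (w i).1) *
            (F1 r ϑ w i j * (1 - Real.exp (-(F1 r ϑ w i j))))) z
      localGibbsLaw σ a₀ u₀ θ₀ N (Φ N) {z | M < P z} ≤ ENNReal.ofReal δ

/-- CARD 2 consequence (`EntropicMaxwellisation`): frequent collisions (RateFloor) plus a bounded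
production budget force the TIME-INTEGRATED Boltzmann entropy production of the mollified empirical
law — the tree's `entropyProduction` against `hardSphereKernel` — to vanish in probability
(`≤ C · Kn · budget / g₀`): entropic local Maxwellianity WITHOUT any chaos hypothesis. -/
def EntropicMaxwellisation : Prop :=
  ∃ η₀ : ℝ, 0 < η₀ ∧ ∀ (a₀ θ₀ : T3 → ℝ) (u₀ : T3 → V3), Continuous a₀ → Continuous θ₀ →
    Continuous u₀ → (∀ x, 0 < a₀ x) → (∀ x, 0 < θ₀ x) → ∃ σ₀ : ℝ, 0 < σ₀ ∧ ∀ σ : ℝ, 0 < σ → σ < σ₀ →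
    ∀ Φ : (N : ℕ) → HardSphereFlow G3 (hsDiameter σ N) (N + 1), ∀ τ : ℝ, 0 < τ →
    ∀ χ : ℝ × T3 → ℝ, Continuous χ → (∀ p, 0 ≤ χ p) →
    ∀ g : ℝ → ℝ, Continuous g → (∀ a, 0 ≤ g a) → (∀ a, η₀ ≤ a → g a = 0) →
    ∀ η δ : ℝ, 0 < η → 0 < δ → ∃ r₀ : ℝ, 0 < r₀ ∧ ∀ r ϑ : ℝ, 0 < r → r < r₀ → 0 < ϑ → ϑ < r₀ →
    ∃ N₀ : ℕ, ∀ N : ℕ, N₀ ≤ N →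
      let D : Config (N + 1) (Fin 3) T3 → ℝ := fun z =>
        ∫ s in Set.Icc (0 : ℝ) τ, ∫ x : T3,
          χ (s, x) * g (σ ^ 3 * ρm r ((Φ N).flow s z) x) *
            entropyProduction hardSphereKernel (hm r ϑ ((Φ N).flow s z) x)
      localGibbsLaw σ a₀ u₀ θ₀ N (Φ N) {z | η < D z} ≤ ENNReal.ofReal δ

/-! ## Card 3 — `resibois-offset-identity` -/

/-- CARD 3 stub (`OffsetIsConfigurational`): the Enskog OFFSET part of the surprisal-jump sum
(two-point minus one-point jump, `O(ε)` per collision, per-unit-time normalised) equals minus the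
weak material derivative of the configurational entropy `H_C = ρ f_ex(ρσ³)` of the coarse fields,
in probability (`N → ∞` at fixed `r, ϑ`, then `r, ϑ → 0`): Résibois' thermodynamic-consistency
identity read on the empirical contact statistics — Euler precision in the contact VALUE. -/
def OffsetIsConfigurational : Prop :=
  ∀ (a₀ θ₀ : T3 → ℝ) (u₀ : T3 → V3), Continuous a₀ → Continuous θ₀ → Continuous u₀ →
    (∀ x, 0 < a₀ x) → (∀ x, 0 < θ₀ x) → ∃ σ₀ : ℝ, 0 < σ₀ ∧ ∀ σ : ℝ, 0 < σ → σ < σ₀ →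
    ∀ Φ : (N : ℕ) → HardSphereFlow G3 (hsDiameter σ N) (N + 1), ∀ τ : ℝ, 0 < τ →
    ∀ φ : ℝ → T3 → ℝ, Literature.Analysis.FunctionSpaces.Torus.IsSmoothSpaceTimeOn Set.univ φ →
    (∃ τ' : ℝ, τ' < τ ∧ ∀ s, τ' ≤ s → ∀ x, φ s x = 0) →
    ∀ η δ : ℝ, 0 < η → 0 < δ → ∃ r₀ : ℝ, 0 < r₀ ∧ ∀ r ϑ : ℝ, 0 < r → r < r₀ → 0 < ϑ → ϑ < r₀ →
    ∃ N₀ : ℕ, ∀ N : ℕ, N₀ ≤ N →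
      let ε := hsDiameter σ N
      let γ : Config (N + 1) (Fin 3) T3 → ℝ → Config (N + 1) (Fin 3) T3 := fun z s => (Φ N).flow s z
      let Koff : Config (N + 1) (Fin 3) T3 → ℝ := fun z =>
        (2 * ε)⁻¹ * Kc σ N (Φ N) τ (fun w s i j => φ s (w i).1 * (F2 r ϑ w i j - F1 r ϑ w i j)) z
      let IC : Config (N + 1) (Fin 3) T3 → ℝ := fun z =>
        ∫ s in Set.Icc (0 : ℝ) τ, ∫ x : T3,
          HC σ (ρm r (γ z s) x) *
            (deriv (fun s' => φ s' x) s +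
              ∑ k : Fin 3, (mm r (γ z s) x) k / ρm r (γ z s) x *
                Literature.Analysis.FunctionSpaces.Torus.partialDeriv k (φ s) x)
      let D : Config (N + 1) (Fin 3) T3 → ℝ := fun z =>
        Koff z + IC z + ∫ x : T3, HC σ (ρm r (γ z 0) x) * φ 0 x
      localGibbsLaw σ a₀ u₀ θ₀ N (Φ N) {z | η < |D z|} ≤ ENNReal.ofReal δ

end Summit.AtomisticToContinuum.HydrodynamicLimit.Cruxes.LocalSecondLaw.IdeatorTwo
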